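import Summits.QuantumFields.BalabanUV.Beta.RemainderExplicitHistoryDiagonalRateEverywhere
import Summits.QuantumFields.BalabanUV.Beta.RemainderExplicitHistoryDiagonalRatePowerTailOne

/-!
# RemainderExplicitHistoryDiagonalRateBeyondHalf — ROAD P3, ORDER-0 PROFILE FAMILY: THE RATE IN THE CUTOFF BEYOND THE INFRARED HALF, BOTH
# SIDES — (§1) the classes of generations 49–50 with NON-summable tails (borderline profile `q = 1∕2`, power tails `0 < q < 1`, harmonic tail
# `q = 1`) obey `astar g m − invSq g m n ≤ (4C_w∕√b)·√m·τ(n+1)` for EVERY cutoff `n` under the box-type smallness `2Wγ < b`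
# (`C_w = (1−Wγ∕b)∕(1−2Wγ∕b)`; the second file fed with their (T2) constants `18√2·M`, `T₀(4∕(1−q) + 2∕q)`, `6T₀`; no (T1), no `κA₁`); (§2) the
# LOWER side at EVERY infrared distance under `Wγ < b`: `√σ₁·τ′(n+m) ≲ astar g m − invSq g m n` for any infrared-half distance `σ₁ ≤ m` of the
# run `n + m` — beyond the half `σ₁ = ⌊(n+m+1)∕2⌋`; (§3) for SMALL profiles (`C_wA₂ ≤ b√b`) no threshold is left: the upper rate at every
# `m ≥ 1` and every `n` (fifth file of station S-d4p3-g51-1 «the tails alone buy the rate»)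

Cell `pub-balaban`, β-function sub-cell, BINDER row D4 «RemainderConst leaves for Bałaban's split» (`HOME/BINDER-OWNERS.md`; owner
lineage `b2b-balaban-beta-an4`; this file by co-owner #3 lineage `b2b-balaban-beta-d4-p3`, road P3 «the reduction road», generation 51,
station S-d4p3-g51-1, fifth file; imports the station's second file `RemainderExplicitHistoryDiagonalRateEverywhere` and generation 50's
`…RatePowerTailOne` (hence generations 49–50's `…RateBorderline`, `…RatePowerShapes`, `…RateLower`)), β-FLOW TEAM duty (1); FREEZE (0) honoured (def-free module
in road P3's own `RemainderExplicit*` series; no leaf, no interface, no Literature file).  SOURCE OF THE SHAPES ONLY: [Balaban1987RG1] (0.20)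
p. 256, (0.31) and Thm 2 p. 259, §5 p. 298.  Pure real analysis about ONE explicit toy family (ours, not Bałaban's).

HONEST FRAMING (page 1 of everything the β sub-cell writes).  *"Discharging BetaPertH makes Bałaban's UV stability UNCONDITIONAL — a real
constructive-QFT result; it is NOT the continuum limit and NOT the Clay problem."*  THIS FILE DISCHARGES NOTHING OF THE KIND.  Generations
49–50 proved the rate `√m·τ(n+1)` for the borderline profile and for every power tail `0 < q < 2` at the infrared distances `m ≤ n + 1` of the
infrared half, through (T1) ∕ (T2).  The second file of this station needs (T2) only and no half; the third file used it for the summable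
tails `q > 1` (both smallness variants).  For the non-summable tails `q ≤ 1` the cutoff-threshold variant (which needs `Σ_k τ(k+1) < ∞`) is
not available, but the box-type variant (`2Wγ < b`, the smallness of generation 47's `runFamily_exists`) is: §1 records it, so that
after the station EVERY class of the census has its upper-side rate for every cutoff.  §2 is the lower side at every infrared distance: the
LOWER window law holds at every position with the constant `1∕(1 − Wγ∕b)` (g49's `window_lower_max` + g50's `max_disc_le_disc_div`), and g49's
family lower bound at an infrared-half distance `σ₁` of the run transfers to every larger `m` by g50's comparison — so beyond the half the
continuum discrepancy is squeezed between `√((n+m)∕2)·τ′(n+m)` and `√m·τ(n+1)` (matching only up to the half, as it must: the window source of a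
position deep in the ultraviolet is not priced by the tail at the cutoff alone).  Nothing of Bałaban's (1.22) is asserted or constructed;
row D4 class UNCHANGED (critical-path width 0; instance 0∕1; D4 DISCHARGE NO DATE); NOT B12 Thm 2, NOT BetaPertH, NOT continuum, NOT Clay.
HONEST DEPENDENCY: continuum YM on T⁴ ⇐ BetaPertH ∧ nine spine estimates (0/9 proved); BetaPertH ⇐ (D1) ∧ (D4) ∧ CAP+tail; G-an2-4 gates
asym, D1 and NE2/3/4.  ABSOLUTE RULE: nothing is cited as a fact.

WHAT IS PROVED ([folklore]; 0 sorry; 0 `def`).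
* §1 (`2Wγ < b`, `C_w = (1−Wγ∕b)∕(1−2Wγ∕b)`, all cutoffs `n`) **`borderline_rate_everywhere`** (`ρ(a) = M∕((a+1)√(a+1))`: `C_w·18√2M ≤ b√b√m` ⇒
  `0 ≤ astar g m − invSq g m n ≤ (4C_w∕√b)√m·3M∕√(n+2)`), **`powerTailLow_rate_everywhere`** (`0 < q < 1`: `C_w·T₀(4∕(1−q)+2∕q) ≤ b√b√m` ⇒
  `≤ (4C_w∕√b)√m·T₀∕(n+2)^q`), **`powerTailOne_rate_everywhere`** (`q = 1`: `C_w·6T₀ ≤ b√b√m` ⇒ `≤ (4C_w∕√b)√m·T₀∕(n+2)`).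
* §2 (`Wγ < b`) **`sum_extra_le_disc_div`** (`Σ_{j∈[j₀,K)} E_j ≤ d_{j₀}∕(1 − Wγ∕b)` at EVERY position `j₀ ≤ K`), **`astar_sub_invSq_rate_lower_everywhere`**
  (`1 ≤ σ₁ ≤ m`, `2σ₁ ≤ n+m+1` ⇒ `√σ₁·τ′(n+m) ≤ 8κ₂√b₂(1+Wγ∕b)·(astar g m − invSq g m n)∕(1 − Wγ∕b)`), `powerTail_rate_lower_everywhere`
  (minorant `T₁∕(k+1)^q`).
* §3 **`astar_sub_invSq_le_rate_global`** (`2Wγ < b`, `C_wA₂ ≤ b√b` ⇒ the upper rate at EVERY `m ≥ 1`, EVERY `n`), **`astar_sub_invSq_le_rate_global_tail`**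
  (`Wγ < b`, `2A₂ ≤ b√b`, `2√2Ts ≤ (1−Wγ∕b)b√b` ⇒ `≤ (8∕√b)√m·τ(n+1)` at EVERY `m ≥ 1`, EVERY `n`) — for small profiles no threshold is left.
All letters NOT-IN-PRINT; `BetaFlowAsPrinted S` records a Markov β_n only ⇒ no junction of the as-printed interface changes.
-/

noncomputable section

open Finset Filter Topology

namespace Summit.QuantumFields.BalabanUV.Beta.RemainderExplicitHistoryDiagonalRateBeyondHalf

open Literature.MathematicalPhysics.QuantumFieldTheory.Balaban1983to89
open Literature.MathematicalPhysics.QuantumFieldTheory.Balaban1983to89.FlowStep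
open Literature.MathematicalPhysics.QuantumFieldTheory.Balaban1983to89.T4CouplingMatching
open Literature.MathematicalPhysics.QuantumFieldTheory.Balaban1983to89.T4ContinuumCoupling
open Summit.QuantumFields.BalabanUV.Beta.RemainderExplicitHistoryDiagonalRateBorderline (borderline_tail_le borderline_T2)
open Summit.QuantumFields.BalabanUV.Beta.RemainderExplicitHistoryDiagonalRatePowerShapes (powerTail_T2)
open Summit.QuantumFields.BalabanUV.Beta.RemainderExplicitHistoryDiagonalRatePowerTail (powerTail_antitone)
open Summit.QuantumFields.BalabanUV.Beta.RemainderExplicitHistoryDiagonalRatePowerTailOne (powerTailOne_T2)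
open Summit.QuantumFields.BalabanUV.Beta.RemainderExplicitHistoryDiagonalWindow (window_lower_max)
open Summit.QuantumFields.BalabanUV.Beta.RemainderExplicitHistoryDiagonalComparison (max_disc_le_disc_div astar_sub_invSq_comparison)
open Summit.QuantumFields.BalabanUV.Beta.RemainderExplicitHistoryDiagonalRateLower (astar_sub_invSq_rate_lower)
open Summit.QuantumFields.BalabanUV.Beta.RemainderExplicitHistoryDiagonalRateEverywhere

variable {β : HBeta} {b γ W : ℝ} {ρ : ℕ → ℝ}

/-! ## §1 The upper side for every cutoff, non-summable tails (`2Wγ < b`) -/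

/-- **THE BORDERLINE PROFILE, EVERY CUTOFF** (`2Wγ < b`).  A pinned family of runs of the order-0 profile family with
`ρ(a) = M∕((a+1)√(a+1))` (`M > 0`), in ]0,γ], `Σ_{a<N} ρ_a ≤ W`, `2Wγ < b`; `C_w = (1−Wγ∕b)∕(1−2Wγ∕b)`.  THEN for every `m` with `C_w·18√2·M ≤ b√b·√m` and
EVERY cutoff `n`: `0 ≤ astar g m − invSq g m n ≤ (4C_w∕√b)·√m·3M∕√(n+2)` — generation 49's `borderline_rate` needed `m ≤ n + 1` and carried
`Λ = 4∕√b + 24√2κ∕((1−Wγ∕b)√b)`. [cite: Balaban1987RG1, (0.20) p.256, (0.31) and Thm 2 p.259] -/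
theorem borderline_rate_everywhere {M : ℝ}
    (hβ : ∀ (k : ℕ) (p : Fin (k + 1) → ℝ),
      β k p = b + ∑ i : Fin (k + 1), ρ (k - i) * min (p (Fin.last k)) (|p (Fin.last k) - p i|))
    (hb : 0 < b) (hγ : 0 < γ) (hM : 0 < M) (hρ : ∀ a, ρ a = M / (((a : ℝ) + 1) * Real.sqrt ((a : ℝ) + 1)))
    (hρW : ∀ n, ∑ a ∈ range n, ρ a ≤ W) (hsmall2 : 2 * W * γ < b)
    {g : ℕ → ℕ → ℝ} {gIR : ℝ} (hrun : ∀ K, RGEqH K β (g K)) (hbox : ∀ K i, i ≤ K → 0 < g K i ∧ g K i ≤ γ)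
    (hpin : ∀ K, g K K = gIR) {m : ℕ}
    (hm : (1 - W * γ / b) / (1 - 2 * W * γ / b) * (18 * Real.sqrt 2 * M) ≤ b * Real.sqrt b * Real.sqrt (m : ℝ)) (n : ℕ) :
    0 ≤ astar g m - invSq g m n ∧ astar g m - invSq g m n
      ≤ 4 * ((1 - W * γ / b) / (1 - 2 * W * γ / b)) / Real.sqrt b * Real.sqrt (m : ℝ)
        * (3 * M / Real.sqrt ((((n + 1 : ℕ) : ℝ)) + 1)) := by
  have hρ0 : ∀ a, 0 ≤ ρ a := fun a => by rw [hρ a]; positivity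
  have hτ0 : ∀ k : ℕ, 0 ≤ 3 * M / Real.sqrt ((k : ℝ) + 1) := fun k => by positivity
  have hτmono : ∀ k l : ℕ, k ≤ l → 3 * M / Real.sqrt ((l : ℝ) + 1) ≤ 3 * M / Real.sqrt ((k : ℝ) + 1) := by
    intro k l hkl
    exact div_le_div_of_nonneg_left (by positivity) (Real.sqrt_pos.2 (by positivity))
      (Real.sqrt_le_sqrt (by exact_mod_cast Nat.add_le_add_right hkl 1))
  exact astar_sub_invSq_le_rate_everywhere (τ := fun k => 3 * M / Real.sqrt ((k : ℝ) + 1)) (A₂ := 18 * Real.sqrt 2 * M)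
    hβ hb hγ hρ0 hρW hsmall2 hτ0 hτmono (fun k N hkN => borderline_tail_le hM.le hρ hkN) (fun j₀ => borderline_T2 M j₀)
    hrun hbox hpin hm n

/-- **EVERY POWER TAIL `0 < q < 1`, EVERY CUTOFF** (`2Wγ < b`).  Tail majorant `R(N) − R(k) ≤ T₀∕(k+1)^q` (`T₀ ≥ 0`); for every `m` with
`C_w·T₀(4∕(1−q) + 2∕q) ≤ b√b·√m` and EVERY cutoff `n`: `0 ≤ astar g m − invSq g m n ≤ (4C_w∕√b)·√m·T₀∕(n+2)^q` — generation 49's `powerTail_rate`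
without `m ≤ n + 1`, (T1) and `κA₁`. [cite: Balaban1987RG1, (0.20) p.256, (0.31) and Thm 2 p.259] -/
theorem powerTailLow_rate_everywhere {T₀ q : ℝ}
    (hβ : ∀ (k : ℕ) (p : Fin (k + 1) → ℝ),
      β k p = b + ∑ i : Fin (k + 1), ρ (k - i) * min (p (Fin.last k)) (|p (Fin.last k) - p i|))
    (hb : 0 < b) (hγ : 0 < γ) (hρ0 : ∀ a, 0 ≤ ρ a) (hρW : ∀ n, ∑ a ∈ range n, ρ a ≤ W) (hsmall2 : 2 * W * γ < b)
    (hq0 : 0 < q) (hq1 : q < 1) (hT₀ : 0 ≤ T₀)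
    (hτ : ∀ k N : ℕ, k ≤ N → ∑ a ∈ range N, ρ a - ∑ a ∈ range k, ρ a ≤ T₀ / ((k : ℝ) + 1) ^ q)
    {g : ℕ → ℕ → ℝ} {gIR : ℝ} (hrun : ∀ K, RGEqH K β (g K)) (hbox : ∀ K i, i ≤ K → 0 < g K i ∧ g K i ≤ γ)
    (hpin : ∀ K, g K K = gIR) {m : ℕ}
    (hm : (1 - W * γ / b) / (1 - 2 * W * γ / b) * (T₀ * (4 / (1 - q) + 2 / q)) ≤ b * Real.sqrt b * Real.sqrt (m : ℝ)) (n : ℕ) :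
    0 ≤ astar g m - invSq g m n ∧ astar g m - invSq g m n
      ≤ 4 * ((1 - W * γ / b) / (1 - 2 * W * γ / b)) / Real.sqrt b * Real.sqrt (m : ℝ) * (T₀ / ((((n + 1 : ℕ) : ℝ)) + 1) ^ q) :=
  astar_sub_invSq_le_rate_everywhere (τ := fun k => T₀ / ((k : ℝ) + 1) ^ q) (A₂ := T₀ * (4 / (1 - q) + 2 / q))
    hβ hb hγ hρ0 hρW hsmall2 (fun k => by positivity) (fun _ _ hkl => powerTail_antitone hT₀ hq0.le hkl) hτ
    (fun j₀ => powerTail_T2 hq0 hq1 j₀) hrun hbox hpin hm n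

/-- **THE HARMONIC TAIL `q = 1`, EVERY CUTOFF** (`2Wγ < b`).  Tail majorant `R(N) − R(k) ≤ T₀∕(k+1)` (`T₀ ≥ 0`); for every `m` with `C_w·6T₀ ≤ b√b·√m`
and EVERY cutoff `n`: `0 ≤ astar g m − invSq g m n ≤ (4C_w∕√b)·√m·T₀∕(n+2)` — generation 50's `powerTailOne_rate` without `m ≤ n + 1`, (T1) and `κA₁`.
[cite: Balaban1987RG1, (0.20) p.256, (0.31) and Thm 2 p.259] -/
theorem powerTailOne_rate_everywhere {T₀ : ℝ}
    (hβ : ∀ (k : ℕ) (p : Fin (k + 1) → ℝ),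
      β k p = b + ∑ i : Fin (k + 1), ρ (k - i) * min (p (Fin.last k)) (|p (Fin.last k) - p i|))
    (hb : 0 < b) (hγ : 0 < γ) (hρ0 : ∀ a, 0 ≤ ρ a) (hρW : ∀ n, ∑ a ∈ range n, ρ a ≤ W) (hsmall2 : 2 * W * γ < b) (hT₀ : 0 ≤ T₀)
    (hτ : ∀ k N : ℕ, k ≤ N → ∑ a ∈ range N, ρ a - ∑ a ∈ range k, ρ a ≤ T₀ / ((k : ℝ) + 1))
    {g : ℕ → ℕ → ℝ} {gIR : ℝ} (hrun : ∀ K, RGEqH K β (g K)) (hbox : ∀ K i, i ≤ K → 0 < g K i ∧ g K i ≤ γ)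
    (hpin : ∀ K, g K K = gIR) {m : ℕ}
    (hm : (1 - W * γ / b) / (1 - 2 * W * γ / b) * (6 * T₀) ≤ b * Real.sqrt b * Real.sqrt (m : ℝ)) (n : ℕ) :
    0 ≤ astar g m - invSq g m n ∧ astar g m - invSq g m n
      ≤ 4 * ((1 - W * γ / b) / (1 - 2 * W * γ / b)) / Real.sqrt b * Real.sqrt (m : ℝ) * (T₀ / ((((n + 1 : ℕ) : ℝ)) + 1)) := by
  have hτ0 : ∀ k : ℕ, 0 ≤ T₀ / ((k : ℝ) + 1) := fun k => by positivity
  have hτmono : ∀ k l : ℕ, k ≤ l → T₀ / ((l : ℝ) + 1) ≤ T₀ / ((k : ℝ) + 1) := fun k l hkl =>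
    div_le_div_of_nonneg_left hT₀ (by positivity) (by exact_mod_cast Nat.add_le_add_right hkl 1)
  exact astar_sub_invSq_le_rate_everywhere (τ := fun k => T₀ / ((k : ℝ) + 1)) (A₂ := 6 * T₀)
    hβ hb hγ hρ0 hρW hsmall2 hτ0 hτmono hτ (fun j₀ => powerTailOne_T2 (T₀ := T₀) j₀) hrun hbox hpin hm n

/-! ## §2 The lower side at every infrared distance (`Wγ < b`, no other smallness) -/

/-- **LOWER WINDOW LAW AT EVERY POSITION, ONE CONSTANT** (`Wγ < b`).  Two runs of the order-0 profile family in ]0,γ] — A: `K` steps, B: `K + n`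
steps — pinned; at EVERY position `j₀ ≤ K` the window's extra-age source is at most the discrepancy there:
`Σ_{j∈[j₀,K)} E_j ≤ d_{j₀}∕(1 − Wγ∕b)` (g49's `window_lower_max` with the window maximum `≤ d_{j₀}∕(1 − Wγ∕b)` of g50's `max_disc_le_disc_div`).
[cite: Balaban1987RG1, (0.20) p.256, (0.31) and Thm 2 p.259] -/
theorem sum_extra_le_disc_div
    (hβ : ∀ (k : ℕ) (p : Fin (k + 1) → ℝ),
      β k p = b + ∑ i : Fin (k + 1), ρ (k - i) * min (p (Fin.last k)) (|p (Fin.last k) - p i|))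
    (hb : 0 < b) (hγ : 0 < γ) (hρ0 : ∀ a, 0 ≤ ρ a) (hρW : ∀ n, ∑ a ∈ range n, ρ a ≤ W) (hsmall : W * γ < b) {K n : ℕ}
    {gA gB : ℕ → ℝ} (hA : RGEqH K β gA) (hB : RGEqH (K + n) β gB) (hAbox : ∀ k, k ≤ K → 0 < gA k ∧ gA k ≤ γ)
    (hBbox : ∀ k, k ≤ K + n → 0 < gB k ∧ gB k ≤ γ) (hpin : gA K = gB (K + n)) {j₀ : ℕ} (hj₀ : j₀ ≤ K) :
    ∑ j ∈ Ico j₀ K, ∑ i ∈ range n, ρ (j + n - i) * (gB (j + n) - gB i)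
      ≤ (1 / (gB (j₀ + n)) ^ 2 - 1 / (gA j₀) ^ 2) / (1 - W * γ / b) := by
  have hApos : ∀ k, k ≤ K → 0 < gA k := fun k hk => (hAbox k hk).1
  have hBpos : ∀ k, k ≤ K + n → 0 < gB k := fun k hk => (hBbox k hk).1
  have hc : 0 < 1 - W * γ / b := by
    have : W * γ / b < 1 := (div_lt_one hb).mpr hsmall
    linarith
  have hmax := max_disc_le_disc_div hβ hb hγ hρ0 hρW hsmall hA hB hAbox hBpos hpin j₀
  have h := window_lower_max hβ hb hγ hρ0 hρW hA hB hAbox hBbox hpin hj₀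
    (P := (1 / (gB (j₀ + n)) ^ 2 - 1 / (gA j₀) ^ 2) / (1 - W * γ / b))
    (fun i h1 h2 => hmax i (Finset.mem_Icc.mpr ⟨h1, h2⟩))
  set d₀ : ℝ := 1 / (gB (j₀ + n)) ^ 2 - 1 / (gA j₀) ^ 2 with hd₀
  have e : d₀ + W * γ / b * (d₀ / (1 - W * γ / b)) = d₀ / (1 - W * γ / b) := by
    rw [eq_div_iff hc.ne', add_mul, mul_assoc, div_mul_cancel₀ _ hc.ne']
    ring
  linarith [h, e]

/-- **ROAD P3 — THE RATE, LOWER SIDE, AT EVERY INFRARED DISTANCE** (`Wγ < b`).  A pinned family of runs of the order-0 profile family in ]0,γ]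
(`b > 0`, `γ > 0`, `ρ ≥ 0`, `Σ_{a<N} ρ_a ≤ W`, `Wγ < b`) and a tail minorant `τ′` (non-increasing, `τ′(k) ≤ Σ_{a∈[k,N)} ρ(a)` for `k ≥ 1`, `N ≥ 2k`).  THEN
for every infrared distance `m`, every cutoff `n`, and every `σ₁` with `1 ≤ σ₁ ≤ m`, `2σ₁ ≤ n + m + 1` (an infrared-half distance of the run `n+m`):
`√σ₁·τ′(n+m) ≤ 8κ₂√b₂(1 + Wγ∕b)·(astar g m − invSq g m n)∕(1 − Wγ∕b)` — g49's `astar_sub_invSq_rate_lower` at the distance `σ₁` of the same run and g50's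
comparison to the larger distance `m`; for `m ≤ n+1` take `σ₁ = m` (g50's pointwise lower side); beyond the half take `σ₁ = ⌊(n+m+1)∕2⌋`: the lower
side `√((n+m)∕2)·τ′(n+m)`, the upper side (§1 ∕ the second file) `√m·τ(n+1)` — both sides at EVERY `(m, n)`, matching for `m ≤ n + 1`.
[cite: Balaban1987RG1, (0.20) p.256, (0.31) and Thm 2 p.259] -/
theorem astar_sub_invSq_rate_lower_everywhere {τ' : ℕ → ℝ}
    (hβ : ∀ (k : ℕ) (p : Fin (k + 1) → ℝ),
      β k p = b + ∑ i : Fin (k + 1), ρ (k - i) * min (p (Fin.last k)) (|p (Fin.last k) - p i|))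
    (hb : 0 < b) (hγ : 0 < γ) (hρ0 : ∀ a, 0 ≤ ρ a) (hρW : ∀ n, ∑ a ∈ range n, ρ a ≤ W) (hsmall : W * γ < b)
    (hτ'mono : ∀ k l, k ≤ l → τ' l ≤ τ' k)
    (hτ' : ∀ k N, 1 ≤ k → 2 * k ≤ N → τ' k ≤ ∑ a ∈ range N, ρ a - ∑ a ∈ range k, ρ a)
    {g : ℕ → ℕ → ℝ} {gIR : ℝ} (hrun : ∀ K, RGEqH K β (g K)) (hbox : ∀ K i, i ≤ K → 0 < g K i ∧ g K i ≤ γ)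
    (hpin : ∀ K, g K K = gIR) {σ₁ m n : ℕ} (hσ1 : 1 ≤ σ₁) (hσm : σ₁ ≤ m) (hσn : 2 * σ₁ ≤ n + m + 1) :
    Real.sqrt (σ₁ : ℝ) * τ' (n + m)
      ≤ 8 * ((1 / gIR ^ 2 + (b + W * γ)) / b) * Real.sqrt (1 / gIR ^ 2 + (b + W * γ)) * (1 + W * γ / b)
          * ((astar g m - invSq g m n) / (1 - W * γ / b)) := by
  have hW : 0 ≤ W := by simpa using hρW 0
  obtain ⟨m', hm', h⟩ := astar_sub_invSq_rate_lower hβ hb hγ hρ0 hρW hτ'mono hτ' hrun hbox hpin (m := σ₁) (n := n + m - σ₁)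
    hσ1 (by omega)
  rw [show n + m - σ₁ + σ₁ = n + m by omega] at h
  have hcmp := (astar_sub_invSq_comparison hβ hb hγ hρ0 hρW hsmall hrun hbox hpin (hm'.trans hσm) n).2
  exact h.trans (mul_le_mul_of_nonneg_left hcmp (by positivity))

/-- **EVERY POWER-TAIL MINORANT, LOWER SIDE AT EVERY INFRARED DISTANCE** (`Wγ < b`, any `q ≥ 0`): tails `≥ T₁∕(k+1)^q` on `[k, N)` (`k ≥ 1`, `N ≥ 2k`);
for `1 ≤ σ₁ ≤ m`, `2σ₁ ≤ n+m+1`: `√σ₁·T₁∕(n+m+1)^q ≤ 8κ₂√b₂(1+Wγ∕b)·(astar g m − invSq g m n)∕(1 − Wγ∕b)`.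
[cite: Balaban1987RG1, (0.20) p.256, (0.31) and Thm 2 p.259] -/
theorem powerTail_rate_lower_everywhere {T₁ q : ℝ}
    (hβ : ∀ (k : ℕ) (p : Fin (k + 1) → ℝ),
      β k p = b + ∑ i : Fin (k + 1), ρ (k - i) * min (p (Fin.last k)) (|p (Fin.last k) - p i|))
    (hb : 0 < b) (hγ : 0 < γ) (hρ0 : ∀ a, 0 ≤ ρ a) (hρW : ∀ n, ∑ a ∈ range n, ρ a ≤ W) (hsmall : W * γ < b)
    (hq : 0 ≤ q) (hT₁ : 0 ≤ T₁)
    (hτ' : ∀ k N : ℕ, 1 ≤ k → 2 * k ≤ N → T₁ / ((k : ℝ) + 1) ^ q ≤ ∑ a ∈ range N, ρ a - ∑ a ∈ range k, ρ a)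
    {g : ℕ → ℕ → ℝ} {gIR : ℝ} (hrun : ∀ K, RGEqH K β (g K)) (hbox : ∀ K i, i ≤ K → 0 < g K i ∧ g K i ≤ γ)
    (hpin : ∀ K, g K K = gIR) {σ₁ m n : ℕ} (hσ1 : 1 ≤ σ₁) (hσm : σ₁ ≤ m) (hσn : 2 * σ₁ ≤ n + m + 1) :
    Real.sqrt (σ₁ : ℝ) * (T₁ / ((((n + m : ℕ) : ℝ)) + 1) ^ q)
      ≤ 8 * ((1 / gIR ^ 2 + (b + W * γ)) / b) * Real.sqrt (1 / gIR ^ 2 + (b + W * γ)) * (1 + W * γ / b)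
          * ((astar g m - invSq g m n) / (1 - W * γ / b)) :=
  astar_sub_invSq_rate_lower_everywhere (τ' := fun k => T₁ / ((k : ℝ) + 1) ^ q) hβ hb hγ hρ0 hρW hsmall
    (fun _ _ hkl => powerTail_antitone hT₁ hq hkl) hτ' hrun hbox hpin hσ1 hσm hσn

/-! ## §3 Small profiles: the rate at every infrared distance `m ≥ 1` and every cutoff, no threshold left -/

/-- **SMALL PROFILES: THE RATE EVERYWHERE** (`2Wγ < b`).  If the profile's (T2) constant is small against the floor, `C_w·A₂ ≤ b√b`
(`C_w = (1−Wγ∕b)∕(1−2Wγ∕b)`), then for EVERY infrared distance `m ≥ 1` and EVERY cutoff `n`: `0 ≤ astar g m − invSq g m n ≤ (4C_w∕√b)·√m·τ(n+1)` —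
the second file's threshold `C_wA₂ ≤ b√b·√m` holds from `m = 1` on. [cite: Balaban1987RG1, (0.20) p.256, (0.31) and Thm 2 p.259] -/
theorem astar_sub_invSq_le_rate_global {A₂ : ℝ} {τ : ℕ → ℝ}
    (hβ : ∀ (k : ℕ) (p : Fin (k + 1) → ℝ),
      β k p = b + ∑ i : Fin (k + 1), ρ (k - i) * min (p (Fin.last k)) (|p (Fin.last k) - p i|))
    (hb : 0 < b) (hγ : 0 < γ) (hρ0 : ∀ a, 0 ≤ ρ a) (hρW : ∀ n, ∑ a ∈ range n, ρ a ≤ W) (hsmall2 : 2 * W * γ < b)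
    (hτ0 : ∀ k, 0 ≤ τ k) (hτmono : ∀ k l, k ≤ l → τ l ≤ τ k)
    (hτ : ∀ k N, k ≤ N → ∑ a ∈ range N, ρ a - ∑ a ∈ range k, ρ a ≤ τ k)
    (hT2 : ∀ j₀ : ℕ, ∑ i ∈ range j₀, τ (i + 1) * τ (j₀ - i) / ((j₀ + 1 - i : ℕ) : ℝ) ≤ A₂ * τ (j₀ + 1))
    {g : ℕ → ℕ → ℝ} {gIR : ℝ} (hrun : ∀ K, RGEqH K β (g K)) (hbox : ∀ K i, i ≤ K → 0 < g K i ∧ g K i ≤ γ)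
    (hpin : ∀ K, g K K = gIR) (hA₂ : (1 - W * γ / b) / (1 - 2 * W * γ / b) * A₂ ≤ b * Real.sqrt b) {m : ℕ} (hm : 1 ≤ m) (n : ℕ) :
    0 ≤ astar g m - invSq g m n ∧ astar g m - invSq g m n
      ≤ 4 * ((1 - W * γ / b) / (1 - 2 * W * γ / b)) / Real.sqrt b * Real.sqrt (m : ℝ) * τ (n + 1) := by
  have hm1 : (1 : ℝ) ≤ Real.sqrt (m : ℝ) := by
    rw [← Real.sqrt_one]; exact Real.sqrt_le_sqrt (by exact_mod_cast hm)
  have hbsb : 0 < b * Real.sqrt b := by positivity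
  have hthr : (1 - W * γ / b) / (1 - 2 * W * γ / b) * A₂ ≤ b * Real.sqrt b * Real.sqrt (m : ℝ) :=
    hA₂.trans (le_mul_of_one_le_right hbsb.le hm1)
  exact astar_sub_invSq_le_rate_everywhere hβ hb hγ hρ0 hρW hsmall2 hτ0 hτmono hτ hT2 hrun hbox hpin hthr n

/-- **SMALL PROFILES: THE RATE EVERYWHERE** (`Wγ < b`).  If `2A₂ ≤ b√b` and `2√2·Ts ≤ (1 − Wγ∕b)·b√b` (`Ts ≥ Σ_k τ(k+1)`), then for EVERY `m ≥ 1` and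
EVERY cutoff `n`: `0 ≤ astar g m − invSq g m n ≤ (8∕√b)·√m·τ(n+1)`. [cite: Balaban1987RG1, (0.20) p.256, (0.31) and Thm 2 p.259] -/
theorem astar_sub_invSq_le_rate_global_tail {A₂ Ts : ℝ} {τ : ℕ → ℝ}
    (hβ : ∀ (k : ℕ) (p : Fin (k + 1) → ℝ),
      β k p = b + ∑ i : Fin (k + 1), ρ (k - i) * min (p (Fin.last k)) (|p (Fin.last k) - p i|))
    (hb : 0 < b) (hγ : 0 < γ) (hρ0 : ∀ a, 0 ≤ ρ a) (hρW : ∀ n, ∑ a ∈ range n, ρ a ≤ W) (hsmall : W * γ < b)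
    (hτ0 : ∀ k, 0 ≤ τ k) (hτmono : ∀ k l, k ≤ l → τ l ≤ τ k)
    (hτ : ∀ k N, k ≤ N → ∑ a ∈ range N, ρ a - ∑ a ∈ range k, ρ a ≤ τ k) (hTs : ∀ N, ∑ i ∈ range N, τ (i + 1) ≤ Ts)
    (hT2 : ∀ j₀ : ℕ, ∑ i ∈ range j₀, τ (i + 1) * τ (j₀ - i) / ((j₀ + 1 - i : ℕ) : ℝ) ≤ A₂ * τ (j₀ + 1))
    {g : ℕ → ℕ → ℝ} {gIR : ℝ} (hrun : ∀ K, RGEqH K β (g K)) (hbox : ∀ K i, i ≤ K → 0 < g K i ∧ g K i ≤ γ)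
    (hpin : ∀ K, g K K = gIR) (hA₂ : 2 * A₂ ≤ b * Real.sqrt b) (hTs' : 2 * Real.sqrt 2 * Ts ≤ (1 - W * γ / b) * (b * Real.sqrt b))
    {m : ℕ} (hm : 1 ≤ m) (n : ℕ) :
    0 ≤ astar g m - invSq g m n ∧ astar g m - invSq g m n ≤ 8 / Real.sqrt b * Real.sqrt (m : ℝ) * τ (n + 1) := by
  have hc1 : 0 < 1 - W * γ / b := by
    have : W * γ / b < 1 := (div_lt_one hb).mpr hsmall
    linarith
  have hmr : (1 : ℝ) ≤ (m : ℝ) := by exact_mod_cast hm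
  have hm1 : (1 : ℝ) ≤ Real.sqrt (m : ℝ) := by rw [← Real.sqrt_one]; exact Real.sqrt_le_sqrt hmr
  have hmm : (1 : ℝ) ≤ (m : ℝ) * Real.sqrt (m : ℝ) := one_le_mul_of_one_le_of_one_le hmr hm1
  have hbsb : 0 < b * Real.sqrt b := by positivity
  have hthr : 2 * A₂ ≤ b * Real.sqrt b * Real.sqrt (m : ℝ) := hA₂.trans (le_mul_of_one_le_right hbsb.le hm1)
  have hthr2 : 2 * Real.sqrt 2 * Ts ≤ (1 - W * γ / b) * (b * Real.sqrt b) * ((m : ℝ) * Real.sqrt (m : ℝ)) :=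
    hTs'.trans (le_mul_of_one_le_right (by positivity) hmm)
  exact astar_sub_invSq_le_rate_everywhere_tail hβ hb hγ hρ0 hρW hsmall hτ0 hτmono hτ hTs hT2 hrun hbox hpin hthr hthr2 n

end Summit.QuantumFields.BalabanUV.Beta.RemainderExplicitHistoryDiagonalRateBeyondHalf

end
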